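import Literature.MathematicalPhysics.QuantumFieldTheory.Balaban1983to89.B7TransferAnalyticMean
import HarnessLib

/-!
# Route `UnitScaleTilt`, crux K1 «MinimiserStabilityRegPr» (stmt-QuantumFields-19200), stub V2′ `stub_halvingStep` (H), RULING g26-№7 (S3) brick **B3, GENERIC CORE**:
# **THE QUADRATIC REMAINDER OF A HOLOMORPHIC MAP ON A WEIGHTED SUP-BALL** (the Cauchy-on-a-complex-line step of `Prop8Chart.norm_chartLog_sub_fderiv_le_weightedBall`,
# stated ONCE for an arbitrary map `G` — so the single-bar `chartLog`, the double-bar `chartLogFlat` of the re-based chart (B2's letters) and any later chart read it by name)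

Cell `ym3-torus` (HUMAN RULING D-0037: YM ladder rung R3 — not the Clay problem), width seat `ym-ust-19200-w3` gen 4 ((S3) hand B3 under LEAD ★w5-19200 g3).
`--supports stmt-QuantumFields-19200 --as helper`; def-free, 0 sorry.

THE STATEMENT.  Finite index types `α`, `β`; a complete complex normed space `V`; positive weights `w₁ : α → ℝ`; a map `G : (α → V) → (β → V)` with `G 0 = 0`, ℂ-differentiable on the
weighted ball `{Y | ∀ a, w₁ a·‖Y a‖ < R′}` and bounded there componentwise by `B`.  Then for every `Y` of weighted size `≤ r` with `4r ≤ R′` and every `i`: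
`‖G Y i − (fderiv ℂ G 0) Y i‖ ≤ (8B∕R′²)·r²` ([Balaban1985Variational] (44) «|C_j(A)| ≤ C₂(…)²» with `C₂ = 8B∕R′²·(…)`: the weighting isomorphism `Y ↦ (w₁ a·Y a)_a` turns the
weighted ball into a sup ball, and `B7TransferAnalyticMean.norm_sub_sub_fderiv_le_of_line` is the second-order Cauchy estimate along the complex line through `0` and `Y`).
Also: `isOpen_weightedBall`, `zero_mem_weightedBall`, `differentiableAt_of_weightedBall` (differentiability at `0` comes for free), and the `r < R′∕4`-form
`norm_sub_fderiv_le_weightedBall'` with the vacuous negative-`r` case discharged on a nonempty `α`.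
HONEST SCOPE: a generic calculus lemma (the engine's own step, factored); NOT a claim about the stub, the crux, the rung or the mass gap.

References: T. Bałaban, CMP **102** (1985) 277–309 [Balaban1985Variational] ((44) p.285); CMP **98** (1985) 17–51 [Balaban1985Averaging] (Prop. 4 (134)–(135) p.38).
-/

set_option autoImplicit false

noncomputable section

open Metric Set

namespace Summit.QuantumFields.YangMills.Theorems.ChartQuadraticWeighted

open Literature.MathematicalPhysics.QuantumFieldTheory.Balaban1983to89

variable {α β : Type*} [Fintype α] [Fintype β] {V : Type*} [NormedAddCommGroup V] [NormedSpace ℂ V] [CompleteSpace V]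

omit [NormedSpace ℂ V] [CompleteSpace V] in
/-- The weighted sup-ball `{Y | ∀ a, w₁ a·‖Y a‖ < R′}` is open. [folklore] -/
theorem isOpen_weightedBall (w₁ : α → ℝ) (R' : ℝ) : IsOpen {Y : α → V | ∀ a, w₁ a * ‖Y a‖ < R'} := by
  have : {Y : α → V | ∀ a, w₁ a * ‖Y a‖ < R'} = ⋂ a, {Y : α → V | w₁ a * ‖Y a‖ < R'} := by ext Y; simp
  rw [this]
  exact isOpen_iInter_of_finite fun a => isOpen_lt (continuous_const.mul (continuous_apply a).norm) continuous_const

omit [Fintype α] [NormedSpace ℂ V] [CompleteSpace V] in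
/-- `0` lies in every weighted ball of positive radius. [folklore] -/
theorem zero_mem_weightedBall (w₁ : α → ℝ) {R' : ℝ} (hR' : 0 < R') : (0 : α → V) ∈ {Y : α → V | ∀ a, w₁ a * ‖Y a‖ < R'} := by
  intro a; simpa using hR'

omit [CompleteSpace V] in
/-- Differentiability on the weighted ball gives differentiability AT every point of it (open set), in particular at `0`. [folklore] -/
theorem differentiableAt_of_weightedBall {W : Type*} [NormedAddCommGroup W] [NormedSpace ℂ W] (w₁ : α → ℝ) {R' : ℝ} {G : (α → V) → W}
    (hGd : DifferentiableOn ℂ G {Y : α → V | ∀ a, w₁ a * ‖Y a‖ < R'}) {Y : α → V} (hY : ∀ a, w₁ a * ‖Y a‖ < R') : DifferentiableAt ℂ G Y :=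
  hGd.differentiableAt ((isOpen_weightedBall w₁ R').mem_nhds hY)

/-- **THE QUADRATIC REMAINDER OF A HOLOMORPHIC MAP ON A WEIGHTED SUP-BALL**: for positive weights `w₁`, a map `G` with `G 0 = 0`, ℂ-differentiable on the weighted ball
of radius `R′ > 0` and bounded there componentwise by `B`, every `Y` of weighted size `≤ r` with `0 ≤ r`, `4r ≤ R′`, and every component `i`:
`‖G Y i − (fderiv ℂ G 0) Y i‖ ≤ 8·B∕R′² · r²`. [cite: Balaban1985Variational, (44) p.285; Balaban1985Averaging, Prop. 4 (134)-(135) p.38] -/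
theorem norm_sub_fderiv_le_weightedBall (w₁ : α → ℝ) (hwpos : ∀ a, 0 < w₁ a) (G : (α → V) → (β → V)) (hG0 : G 0 = 0)
    {R' B : ℝ} (hR'0 : 0 < R') (hGd : DifferentiableOn ℂ G {Y : α → V | ∀ a, w₁ a * ‖Y a‖ < R'})
    (hGB : ∀ Y : α → V, (∀ a, w₁ a * ‖Y a‖ < R') → ∀ i, ‖G Y i‖ ≤ B)
    (Y : α → V) {r : ℝ} (hr0 : 0 ≤ r) (hr : 4 * r ≤ R') (hY : ∀ a, w₁ a * ‖Y a‖ ≤ r) (i : β) :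
    ‖G Y i - (fderiv ℂ G 0) Y i‖ ≤ 8 * B / R' ^ 2 * r ^ 2 := by
  -- the weighting isomorphism `T Z = (w₁⁻¹·Z)` and the weighted copy `Z` of `Y`
  set T : (α → V) →L[ℂ] (α → V) := ContinuousLinearMap.pi fun a => ((w₁ a : ℂ)⁻¹) • ContinuousLinearMap.proj (R := ℂ) (φ := fun _ => V) a with hT
  have hT_apply : ∀ (Z : α → V) (a : α), T Z a = ((w₁ a : ℂ)⁻¹) • Z a := fun Z a => rfl
  set Z : α → V := fun a => (w₁ a : ℂ) • Y a with hZ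
  have hTZ : T Z = Y := by
    funext a
    rw [hT_apply, hZ]
    simp only [smul_smul]
    rw [inv_mul_cancel₀ (by exact_mod_cast (hwpos a).ne'), one_smul]
  have hZnorm : ‖Z‖ ≤ r := by
    refine (pi_norm_le_iff_of_nonneg hr0).2 fun a => ?_
    rw [hZ]; simp only [norm_smul, Complex.norm_real, Real.norm_eq_abs, abs_of_pos (hwpos a)]
    exact hY a
  -- the component map through the weighting
  set g : (α → V) → V := fun A => G A i with hg
  set Φ : (α → V) → V := fun X => g (T X) with hΦ
  have hmaps : ∀ X : α → V, X ∈ ball (0 : α → V) R' → ∀ a, w₁ a * ‖T X a‖ < R' := by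
    intro X hX a
    rw [mem_ball_zero_iff] at hX
    rw [hT_apply, norm_smul, norm_inv, Complex.norm_real, Real.norm_eq_abs, abs_of_pos (hwpos a), ← mul_assoc, mul_inv_cancel₀ (hwpos a).ne', one_mul]
    exact (norm_le_pi_norm X a).trans_lt hX
  have hΦd : DifferentiableOn ℂ Φ (ball (0 : α → V) R') := by
    intro X hX
    have hgX : DifferentiableAt ℂ g (T X) :=
      (differentiableAt_pi.mp (differentiableAt_of_weightedBall w₁ hGd (hmaps X hX))) i
    exact (hgX.comp X T.differentiableAt).differentiableWithinAt
  have hΦB : ∀ X ∈ ball (0 : α → V) R', ‖Φ X‖ ≤ B := fun X hX => hGB (T X) (hmaps X hX) i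
  -- the Cauchy estimate along the line `t ↦ t•Z`
  have h0 : (0 : α → V) ∈ ball (0 : α → V) R' := mem_ball_self hR'0
  have hv : 4 * ‖Z‖ ≤ R' - ‖(0 : α → V) - 0‖ := by rw [sub_zero, norm_zero, sub_zero]; linarith
  have hC := B7TransferAnalyticMean.norm_sub_sub_fderiv_le_of_line hΦd hΦB h0 hv
  rw [zero_add, sub_self, norm_zero, sub_zero] at hC
  -- identify the three terms
  have hΦZ : Φ Z = G Y i := by rw [hΦ]; simp only [hg]; rw [hTZ]
  have hΦ0 : Φ 0 = 0 := by rw [hΦ]; simp only [hg, map_zero, hG0, Pi.zero_apply]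
  have hdiff0 : DifferentiableAt ℂ G 0 := differentiableAt_of_weightedBall w₁ hGd (zero_mem_weightedBall w₁ hR'0)
  have hg0 : DifferentiableAt ℂ g 0 := (differentiableAt_pi.mp hdiff0) i
  have hfd : fderiv ℂ Φ 0 Z = (fderiv ℂ G 0) Y i := by
    have h1 : fderiv ℂ Φ 0 = (fderiv ℂ g (T 0)).comp T := by
      rw [hΦ]
      exact fderiv_comp 0 (by rw [map_zero]; exact hg0) T.differentiableAt |>.trans (by rw [T.fderiv])
    rw [h1, ContinuousLinearMap.comp_apply, map_zero, hTZ]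
    have h2 : fderiv ℂ g 0 = (ContinuousLinearMap.proj (R := ℂ) (φ := fun _ : β => V) i).comp (fderiv ℂ G 0) :=
      ((hasFDerivAt_pi'.mp hdiff0.hasFDerivAt) i).fderiv
    rw [h2, ContinuousLinearMap.comp_apply, ContinuousLinearMap.proj_apply]
  rw [hΦZ, hΦ0, sub_zero, hfd] at hC
  refine hC.trans ?_
  -- `8·B·‖Z‖²/R′² ≤ (8B/R′²)·r²`
  have hB0 : 0 ≤ B := (norm_nonneg _).trans (hΦB 0 h0)
  have hZ2 : ‖Z‖ ^ 2 ≤ r ^ 2 := pow_le_pow_left₀ (norm_nonneg _) hZnorm 2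
  rw [show 8 * B * ‖Z‖ ^ 2 / R' ^ 2 = 8 * B / R' ^ 2 * ‖Z‖ ^ 2 by ring]
  exact mul_le_mul_of_nonneg_left hZ2 (by positivity)

/-- **THE SAME IN THE `r < R′∕4` LETTER OF `ChartRemainderAt`** (any `r`, the size hypothesis at one index of a NONEMPTY `α` forces `0 ≤ r`): for `G 0 = 0`, `G` holomorphic and
bounded by `B` on the weighted `R′`-ball: `r < R′∕4 → (∀ a, w₁ a·‖Y a‖ ≤ r) → ‖G Y i − (fderiv ℂ G 0) Y i‖ ≤ (128·B∕R′²)·… ` — stated with the constant `8B∕R′²` and the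
radius `R′∕4`, i.e. `C₂ := 8B∕R′²`, `R := R′∕4`. [cite: Balaban1985Variational, (44) p.285] -/
theorem norm_sub_fderiv_le_weightedBall' [Nonempty α] (w₁ : α → ℝ) (hwpos : ∀ a, 0 < w₁ a) (G : (α → V) → (β → V)) (hG0 : G 0 = 0)
    {R' B : ℝ} (hR'0 : 0 < R') (hGd : DifferentiableOn ℂ G {Y : α → V | ∀ a, w₁ a * ‖Y a‖ < R'})
    (hGB : ∀ Y : α → V, (∀ a, w₁ a * ‖Y a‖ < R') → ∀ i, ‖G Y i‖ ≤ B)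
    (Y : α → V) {r : ℝ} (hr : r < R' / 4) (hY : ∀ a, w₁ a * ‖Y a‖ ≤ r) (i : β) :
    ‖G Y i - (fderiv ℂ G 0) Y i‖ ≤ 8 * B / R' ^ 2 * r ^ 2 := by
  obtain ⟨a₀⟩ := ‹Nonempty α›
  have hr0 : 0 ≤ r := (mul_nonneg (hwpos a₀).le (norm_nonneg _)).trans (hY a₀)
  exact norm_sub_fderiv_le_weightedBall w₁ hwpos G hG0 hR'0 hGd hGB Y hr0 (by linarith) hY i

end Summit.QuantumFields.YangMills.Theorems.ChartQuadraticWeighted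

end
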